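import Summits.NavierStokesRegularity.NavierStokesRegularity.Theses.AdaptedFrequency
import Summits.NavierStokesRegularity.NavierStokesRegularity.Theorems.AdaptedFrequencyAdaptedKernelExistsExpMoment
import Summits.NavierStokesRegularity.NavierStokesRegularity.Theorems.AdaptedFrequencyAdaptedKernelExistsUpperOfMoments
import Summits.NavierStokesRegularity.NavierStokesRegularity.Theorems.AdaptedFrequencyAdaptedKernelExistsLowerOfUpper
import Summits.NavierStokesRegularity.NavierStokesRegularity.Theorems.AdaptedFrequencyAdaptedKernelExistsWeakCorrector
import Summits.NavierStokesRegularity.NavierStokesRegularity.Theorems.AdaptedFrequencyAdaptedKernelExistsHypoelliptic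
import Summits.NavierStokesRegularity.NavierStokesRegularity.Theorems.AdaptedFrequencyAdaptedKernelExistsPrekernelBounds
import Summits.NavierStokesRegularity.NavierStokesRegularity.Theorems.AdaptedFrequencyAdaptedKernelExistsKernelPackaging
import Summits.NavierStokesRegularity.NavierStokesRegularity.Theorems.AdaptedFrequencyAdaptedKernelExistsKernelLimit
import Summits.NavierStokesRegularity.NavierStokesRegularity.Theorems.AdaptedFrequencyAdaptedKernelExistsTypeICutoff

/-!
# Crux `AdaptedKernelExists` (stmt-NavierStokesRegularity-2956) of route `AdaptedFrequency` — PROVED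
  (line `nash-entropy-last-block`, gen-4 skeleton `Cruxes/AdaptedKernelExists/Lines/nash_entropy_last_block.lean`)

Under the Type-I rate an adapted backward kernel of `∂ₜ + u·∇ − νΔ` ending at `δ_{x₀}` at the
singular time `T` exists for every `x₀` and is two-sided Gaussian-comparable UNIFORMLY down to `T`.
This file is the sorry-free composition of the seven landed stubs of the line:

* a-priori structure on the last block: `stub_expMoment` (exponential moment law across the
  blocks), `stub_upperOfMoments` (Gaussian upper bound: tightness + supersolution `k₊`),
  `stub_lowerOfUpper` (Gaussian lower bound: bulk mass + subsolution `k₋`);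
* existence for a regular (cut-off) pole: `stub_weakCorrector` (very weak `L²` corrector by
  J.-L. Lions' projection lemma), `stub_hypoelliptic` (Hörmander's hypoellipticity theorem,
  proved in the tree, for `∂ₜ + b·∇ + νΔ = Σ(√ν∂ⱼ)² + X₀`), `stub_prekernelBounds` (positivity and
  upper comparison: Lieberman's local maximum principle, paraboloid comparison, kernel lower
  bound), `stub_kernelPackaging` (envelope, unit mass, concentration) — composed in `cauchyKernel`;
* passage to the singular pole: `stub_kernelLimit` (equicontinuity + very weak limit +
  hypoellipticity);
* glue: the smooth temporal cut-off of the Type-I drift (`kernel_typeI_cutoff`, landed), the linear theorem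
  `linearTypeIDriftKernel` (constants depending on `(ν, C)` only), and the transfer to the crux
  (`adaptedFrequency_adaptedKernelExists_proof`, which concludes the route decl BY NAME).
-/

noncomputable section

open MeasureTheory Set Filter Topology Metric
open scoped ContDiff Laplacian
open Literature.Analysis.FluidPDE
open Summit.NavierStokesRegularity.NavierStokesRegularity.Theorems.AdaptedKernelExists.NashEntropyLastBlock

namespace Summit.NavierStokesRegularity.NavierStokesRegularity.Theorems

/-! ### Existence for a regular pole (stubs 4a–4d) -/

/-- **Existence for a regular pole**: for `ν > 0`, times `tb < tₘ < T`, and a jointly smooth,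
bounded, divergence-free drift `b` on `[tb, T) × ℝ³` vanishing on `[T₁, T)` for some
`T₁ ∈ (tₘ, T)`, there is an adapted backward kernel of `∂ₜ + b·∇ − νΔ` on `Ico tₘ T` with pole
`(T, x₀)` and a Gaussian envelope on `Ioo tₘ T` (`ta := (tb + tₘ)/2`, `Ta := (T₁ + T)/2`; the
corrector of `stub_weakCorrector`, the smooth representative of `stub_hypoelliptic`, positivity
and comparison by `stub_prekernelBounds`, packaging by `stub_kernelPackaging`). -/
theorem cauchyKernel :
    ∀ (ν tb tₘ T : ℝ) (b : ℝ → EuclideanSpace ℝ (Fin 3) → EuclideanSpace ℝ (Fin 3))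
      (x₀ : EuclideanSpace ℝ (Fin 3)), 0 < ν → tb < tₘ → tₘ < T →
      IsSmoothSpaceTimeOn (Ico tb T) b →
      (∀ t ∈ Ico tb T, VectorCalculus.IsDivFree (b t)) →
      (∃ B : ℝ, ∀ t ∈ Ico tb T, ∀ x, ‖b t x‖ ≤ B) →
      (∃ T₁ ∈ Ioo tₘ T, ∀ t ∈ Ico T₁ T, ∀ x, b t x = 0) →
        ∃ G : ℝ → EuclideanSpace ℝ (Fin 3) → ℝ,
          IsAdaptedBackwardKernel ν b (Ico tₘ T) T x₀ G ∧
          ∃ K a : ℝ, 0 < a ∧ ∀ t ∈ Ioo tₘ T, ∀ x,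
            G t x ≤ K * (T - t) ^ (-(3:ℝ) / 2) * Real.exp (-(‖x - x₀‖ ^ 2) / (a * (T - t))) := by
  intro ν tb tₘ T b x₀ hν htb htₘT hsm hdiv hB hT₁
  obtain ⟨B, hB⟩ := hB
  obtain ⟨T₁, hT₁, hvan⟩ := hT₁
  -- the two auxiliary levels
  set ta : ℝ := (tb + tₘ) / 2 with hta_def
  set Ta : ℝ := (T₁ + T) / 2 with hTa_def
  have htba : tb < ta := by rw [hta_def]; linarith
  have htaₘ : ta < tₘ := by rw [hta_def]; linarith
  have hta₁ : ta < T₁ := htaₘ.trans hT₁.1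
  have hT₁a : T₁ < Ta := by rw [hTa_def]; linarith [hT₁.2]
  have hTaT : Ta < T := by rw [hTa_def]; linarith [hT₁.2]
  have htaTa : ta < Ta := hta₁.trans hT₁a
  have htaT : ta < T := htaTa.trans hTaT
  have htₘa : tₘ < Ta := hT₁.1.trans hT₁a
  have hsub : Ico ta T ⊆ Ico tb T := Ico_subset_Ico_left htba.le
  have hsmₐ : IsSmoothSpaceTimeOn (Ico ta T) b := hsm.mono hsub
  have hdivₐ : ∀ t ∈ Ico ta T, VectorCalculus.IsDivFree (b t) := fun t ht => hdiv t (hsub ht)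
  have hBₐ : ∀ t ∈ Ico ta T, ∀ x, ‖b t x‖ ≤ B := fun t ht x => hB t (hsub ht) x
  -- 4a: the corrector
  obtain ⟨w, hwm, hw2, hw0, hloc, hweak⟩ :=
    stub_weakCorrector ν tb ta T₁ Ta T B b x₀ hν htba hta₁ hT₁a hTaT hsm hdiv hB hvan
  -- 4b: the smooth representative of `Γ + w`
  obtain ⟨g, hgs, hae, hcl⟩ :=
    stub_hypoelliptic ν ta T b (fun p => backwardHeatKernel ν T x₀ p.1 p.2 + w p) hν htaT hsmₐ hdivₐ hloc hweak
  -- 4c: positivity and comparison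
  obtain ⟨hΓ, hpos, hcmp⟩ :=
    stub_prekernelBounds ν ta Ta T B b x₀ w g hν htaTa hTaT hsmₐ hBₐ hwm hw2 hw0 hgs hae hcl
  -- 4d: packaging
  obtain ⟨hK, K, a, ha, henv⟩ :=
    stub_kernelPackaging ν ta tₘ Ta T B b x₀ g hν htaₘ htₘa hTaT hsmₐ hdivₐ hBₐ hgs hcl hΓ hpos hcmp
  exact ⟨g, hK, K, a, ha, fun t ht x => henv t ⟨htaₘ.trans ht.1, ht.2⟩ x⟩

/-! ### The linear theorem `C⁺` -/

/-- **The linear theorem `C⁺`**: for every `ν > 0`, `C ≥ 0` there are `c₁, c₂, C₁, C₂ > 0` such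
that every jointly smooth, divergence-free, Type-I drift `‖b(t,x)‖ ≤ C/√(T−t)` on a slab `Ico tb T`
admits, at every `x₀` and on every interior slab `Ico t₀ T` (`tb < t₀ < T`), an adapted backward
kernel with pole `(T, x₀)` obeying the two-sided Gaussian bounds `(c₁, c₂, C₁, C₂)` on `Ico t₀ T`
(constants from stubs 2–3; cut the drift off beyond `T′ ∈ (t₀, T)`, take the kernel of
`cauchyKernel`, bound it by stubs 1 → 2 → 3, pass to the limit with stub 5). -/
theorem linearTypeIDriftKernel :
    ∀ (ν C : ℝ), 0 < ν → 0 ≤ C → ∃ c₁ c₂ C₁ C₂ : ℝ, 0 < c₁ ∧ 0 < c₂ ∧ 0 < C₁ ∧ 0 < C₂ ∧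
      ∀ (tb t₀ T : ℝ) (b : ℝ → EuclideanSpace ℝ (Fin 3) → EuclideanSpace ℝ (Fin 3))
        (x₀ : EuclideanSpace ℝ (Fin 3)), tb < t₀ → t₀ < T →
        IsSmoothSpaceTimeOn (Ico tb T) b →
        (∀ t ∈ Ico tb T, VectorCalculus.IsDivFree (b t)) →
        (∀ t ∈ Ico tb T, ∀ x, ‖b t x‖ ≤ C / Real.sqrt (T - t)) →
        ∃ G : ℝ → EuclideanSpace ℝ (Fin 3) → ℝ,
          IsAdaptedBackwardKernel ν b (Ico t₀ T) T x₀ G ∧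
          (∀ t ∈ Ico t₀ T, ∀ x,
            c₁ * (T - t) ^ (-(3:ℝ) / 2) * Real.exp (-(‖x - x₀‖ ^ 2) / (c₂ * (T - t))) ≤ G t x) ∧
          (∀ t ∈ Ico t₀ T, ∀ x,
            G t x ≤ C₁ * (T - t) ^ (-(3:ℝ) / 2) * Real.exp (-(‖x - x₀‖ ^ 2) / (C₂ * (T - t)))) := by
  intro ν C hν hC
  obtain ⟨C₁, C₂, hC₁, hC₂, hup⟩ := stub_upperOfMoments ν C hν hC
  obtain ⟨c₁, c₂, hc₁, hc₂, hlow⟩ := stub_lowerOfUpper ν C C₁ C₂ hν hC hC₁ hC₂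
  refine ⟨c₁, c₂, C₁, C₂, hc₁, hc₂, hC₁, hC₂, fun tb t₀ T b x₀ htb ht₀ hsm hdiv hrate => ?_⟩
  -- the middle level
  set tₘ : ℝ := (tb + t₀) / 2 with htₘ_def
  have htbₘ : tb < tₘ := by rw [htₘ_def]; linarith
  have htₘ₀ : tₘ < t₀ := by rw [htₘ_def]; linarith
  have htₘT : tₘ < T := htₘ₀.trans ht₀
  have hsubₘ : Ico tₘ T ⊆ Ico tb T := Ico_subset_Ico_left htbₘ.le
  have hbd : ∀ t₁ t₂ : ℝ, tₘ ≤ t₁ → t₂ < T → ∃ Bd : ℝ, ∀ s ∈ Icc t₁ t₂, ∀ x, ‖b s x‖ ≤ Bd := by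
    intro t₁ t₂ h₁ h₂
    refine ⟨C / Real.sqrt (T - t₂), fun s hs x => ?_⟩
    have hsI : s ∈ Ico tb T := ⟨htbₘ.le.trans (h₁.trans hs.1), hs.2.trans_lt h₂⟩
    refine (hrate s hsI x).trans ?_
    exact div_le_div_of_nonneg_left hC (Real.sqrt_pos.2 (by linarith))
      (Real.sqrt_le_sqrt (by linarith [hs.2]))
  refine stub_kernelLimit ν c₁ c₂ C₁ C₂ tₘ t₀ T b x₀ hν hc₁ hc₂ hC₁ hC₂ htₘ₀ ht₀ (hsm.mono hsubₘ)
    (fun t ht => hdiv t (hsubₘ ht)) hbd ?_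
  intro T' hT'₀ hT'T
  obtain ⟨b', hsm', hdiv', hrate', hagree, hdom, hB, T₁, hT₁, hvan⟩ :=
    kernel_typeI_cutoff hC hsm hdiv hrate hT'T
  have hT₁' : T₁ ∈ Ioo tₘ T := ⟨htₘ₀.trans (hT'₀.trans hT₁.1), hT₁.2⟩
  obtain ⟨G', hK', henv'⟩ :=
    cauchyKernel ν tb tₘ T b' x₀ hν htbₘ htₘT hsm' hdiv' hB ⟨T₁, hT₁', hvan⟩
  have hsmₘ : IsSmoothSpaceTimeOn (Ico tₘ T) b' := hsm'.mono hsubₘ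
  have hdivₘ : ∀ t ∈ Ico tₘ T, VectorCalculus.IsDivFree (b' t) := fun t ht => hdiv' t (hsubₘ ht)
  have hrateₘ : ∀ t ∈ Ico tₘ T, ∀ x, ‖b' t x‖ ≤ C / Real.sqrt (T - t) :=
    fun t ht x => hrate' t (hsubₘ ht) x
  have hmom := stub_expMoment ν C tₘ T b' x₀ G' hν hC htₘT hsmₘ hdivₘ hrateₘ hK' henv'
  have hU := hup tₘ T b' x₀ G' htₘT hsmₘ hdivₘ hrateₘ hK' henv' hmom
  have hL := hlow tₘ T b' x₀ G' htₘT hsmₘ hdivₘ hrateₘ hK' hU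
  exact ⟨b', G', fun t ht => hagree t ⟨htbₘ.le.trans ht.1, ht.2.trans_lt hT'T⟩ ht.2, hsmₘ, hdivₘ,
    fun t _ x => hdom t x, hK', hL, hU⟩

/-! ### The crux -/

/-- **Crux `AdaptedKernelExists` of route `AdaptedFrequency` (stmt-NavierStokesRegularity-2956).**
Under the Type-I rate an adapted backward kernel of `∂ₜ + u·∇ − νΔ` ending at `δ_{x₀}` at the
singular time exists for every `x₀` and is two-sided Gaussian-comparable: with the Type-I window
`(t₁, T)` of `IsTypeIBlowup`, take `tb := max (T/4) ((3t₁+T)/4)`, `t₀ := max (T/2) ((t₁+T)/2)`,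
constant `max C 0`, smoothness and `div u = 0` on `[tb, T)` from `IsClassicalNSSolutionOn`, and apply
`linearTypeIDriftKernel`; the five kernel clauses / the comparability clause are the fields of
`IsAdaptedBackwardKernel` / the two Gaussian bounds. Concludes the route decl BY NAME. -/
theorem adaptedFrequency_adaptedKernelExists_proof :
    Summit.NavierStokesRegularity.NavierStokesRegularity.Theses.AdaptedFrequency.AdaptedKernelExists := by
  have hlin := linearTypeIDriftKernel
  intro ν T hν hT u p hns _hLH _hdec hTI x₀
  obtain ⟨C, hC⟩ := hTI
  obtain ⟨t₁, ht₁T, ht₁⟩ := mem_nhdsLT_iff_exists_Ioo_subset.1 hC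
  have ht₁T' : t₁ < T := ht₁T
  set t₀ : ℝ := max (T / 2) ((t₁ + T) / 2) with ht₀_def
  set tb : ℝ := max (T / 4) ((3 * t₁ + T) / 4) with htb_def
  have htb0 : 0 ≤ tb := le_trans (by linarith) (le_max_left _ _)
  have ht₀0 : 0 ≤ t₀ := le_trans (by linarith) (le_max_left _ _)
  have ht₀T : t₀ < T := max_lt (by linarith) (by linarith)
  have htb₀ : tb < t₀ := max_lt_max (by linarith) (by linarith)
  have hwin : ∀ t ∈ Ico tb T, t ∈ Ioo t₁ T := fun t ht =>
    ⟨lt_of_lt_of_le (by linarith [le_max_right (T / 4) ((3 * t₁ + T) / 4)]) ht.1, ht.2⟩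
  have hsub : Ico tb T ⊆ Ico 0 T := Ico_subset_Ico_left htb0
  have hsm : IsSmoothSpaceTimeOn (Ico tb T) u := hns.smooth_velocity.mono hsub
  have hdiv : ∀ t ∈ Ico tb T, VectorCalculus.IsDivFree (u t) := fun t ht => hns.divFree t (hsub ht)
  have hrate : ∀ t ∈ Ico tb T, ∀ x, ‖u t x‖ ≤ max C 0 / Real.sqrt (T - t) := by
    intro t ht x
    have h1 : ‖u t x‖ ≤ C / Real.sqrt (T - t) := ht₁ (hwin t ht) x
    exact h1.trans (div_le_div_of_nonneg_right (le_max_left _ _) (Real.sqrt_nonneg _))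
  obtain ⟨c₁, c₂, C₁, C₂, hc₁, hc₂, hC₁, hC₂, hall⟩ := hlin ν (max C 0) hν (le_max_right _ _)
  obtain ⟨G, hK, hL, hU⟩ := hall tb t₀ T u x₀ htb₀ ht₀T hsm hdiv hrate
  refine ⟨t₀, ⟨ht₀0, ht₀T⟩, G, ⟨hK.contDiffOn, hK.pos, hK.adjoint_eq, hK.integral_eq_one,
    hK.tendsto_integral_mul⟩, c₁, c₂, C₁, C₂, hc₁, hc₂, hC₁, hC₂, fun t ht x => ⟨hL t ht x, hU t ht x⟩⟩

end Summit.NavierStokesRegularity.NavierStokesRegularity.Theorems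

end
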